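/-
Copyright (c) 2026 the pub-hodgecm-mathlib formalisation cell (harness21).  Prover seat hodgecm-mathlib-F0P2-p02 (g26); E1 keeper ∕ dealer F0P3a-p03 (g30), E1 BRICK LEDGER
row 50 «(J) YONEDA FOR A LENGTH-ONE PRESENTATION» (deal 2026-09-03T02:55:13Z, GO-LOW generic under rule 20).
-/
import Literature.Algebra.Module.PullbackAndPushout      -- ★ Fuchs §10: the pushout `(A × B) ⧸ range (α.prod (−β))`, `pushout_inr_injective`
import Mathlib.RepresentationTheory.Intertwining
import Mathlib.LinearAlgebra.FiniteDimensional.Lemmas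
import HarnessLib

/-!
# Extensions along a length-one presentation: if every extension of `V` by `W` splits, every `G`-map `C₁ → W` extends to `C₀` along `0 → C₁ → C₀ → V → 0`,
# and `dim Hom_G(C₀, W) = dim Hom_G(V, W) + dim Hom_G(C₁, W)` («`EP(V, W) = dim Hom(V, W)`» with no derived functor)

Generic representation theory over a commutative ring `k` (a field for the dimension count), any monoid `G`; Mathlib `Representation` ∕ `Representation.IntertwiningMap` ∕
`Representation.prod` ∕ `Representation.quotient` + the tree's ★ `Literature/Algebra/Module/PullbackAndPushout` (Fuchs's PUSHOUT `(A × B) ⧸ range (α.prod (−β))`, cited by name);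
THEOREMS ONLY (no `def`, no instance, no notation, no named fact, no `sorry`).

THE SITUATION.  A LENGTH-ONE PRESENTATION of `V`: intertwining maps `d : C₁ → C₀`, `ε : C₀ → V` with `d` injective, `ker ε = range d`, `ε` surjective (consumer instance: the
Schneider–Stuhler tree complex `0 → C₁(X; V) → C₀(X; V) → V → 0`, ★ rows 34 ∕ 41d), and a target `W` such that **EVERY EXTENSION OF `V` BY `W` SPLITS** — hypothesis-style, in the letters
of ★ G2 ∕ ★ D ∕ ★ D′46 (`hsplit : ∀ E ρE (i : W → E) (p : E → V), i injective → ker p = range i → p surjective → ∃ s, p ∘ s = 1`).  All four spaces live in ONE universe `Type v`, so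
that the pushout below is an admissible `E`.
* §1 THE PUSHOUT EXTENSION of a `G`-map `φ : C₁ → W`: `E_φ := (C₀ × W) ⧸ H`, `H := range (d, −φ)` (★ Fuchs Thm 10.2; `H` is `G`-invariant because `d`, `φ` intertwine —
  `prod_range_le_comap`), with `i : W → E_φ`, `w ↦ [(0, w)]` (injective: ★ `pushout_inr_injective`, `d` monic) and `p : E_φ → V`, `[(c, w)] ↦ ε c` (surjective; `ker p = range i`
  because `ker ε = range d`): **`exists_pushout_extension`** — an EXTENSION OF `V` BY `W`.
* §2 **THE SENTENCE `exists_comp_eq_of_forall_extension_split`**: under `hsplit`, every `φ : C₁ → W` is `ψ ∘ d` for some `G`-map `ψ : C₀ → W` — a section `s` of `p` gives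
  `ψ := i⁻¹ ∘ (c ↦ [(c, 0)] − s (ε c))` (the bracket lies in `ker p = range i`), and `ψ (d c₁) = φ c₁` because `[(d c₁, 0)] = [(0, φ c₁)]`.  Map form `comp_surjective_of_forall_extension_split`:
  the restriction `ψ ↦ ψ ∘ d : Hom_G(C₀, W) → Hom_G(C₁, W)` is SURJECTIVE.  (Yoneda's description of the connecting map `Hom(C₁, W) → Ext¹(V, W)` read backwards: its image is the
  obstruction, and it vanishes.)
* §3 THE FOUR-TERM EXACT SEQUENCE `0 → Hom_G(V, W) → Hom_G(C₀, W) → Hom_G(C₁, W) → 0` (`k` a field): `χ ↦ χ ∘ ε` is injective (`comp_injective_of_surjective`) with image the kernel of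
  the restriction (`comp_eq_zero_iff_exists_comp_eq`: a `G`-map killing `range d = ker ε` descends along the surjection `ε`), whence
  **`finrank_intertwiningMap_presentation`**: `dim_k Hom_G(C₀, W) = dim_k Hom_G(V, W) + dim_k Hom_G(C₁, W)` for `Hom_G(C₀, W)` finite-dimensional — the identity
  «`Σ_q (−1)^q dim Hom_G(C_q, W) = dim Hom_G(V, W)`» that the Euler–Poincaré trace formula needs where `Ext¹_G(V, W) = 0` is known as «extensions split» (★ D ∕ D′46 ∕ 40″), with
  NO derived functor in sight.
Consumers (cell `pub/hodgecm-mathlib`, crux H413, E1 column): the meeting point of ★ rows 42∕45 (`tr σ(f_EP^V) = Σ_q (−1)^q dim Hom_G(C_q, σ)`) with the self-extension splitting files.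
HONEST LABEL: count-neutral generic helper; HC_CM is proved only modulo the printed citations until rung 0 closes.

SOURCES (what is formalised, read at our letters).  [Weibel1994, §3.4 Thm. 3.4.3] (extensions of `A` by `B` ↔ `Ext¹(A, B)`; the class of the pushout of a presentation along
`φ : C₁ → B` is the image of `φ` under the connecting map, and it is trivial iff `φ` extends to `C₀`); [Fuchs1970, §10 Theorem 10.2 and (b) (PDF pp. 52–53)] (the pushout as
`(A ⊕ B) ∕ {(αc, −βc)}`, monic `α` ⇒ monic `δ`); [BernsteinZelevinsky1976, §2.1–§2.4] (Hom bookkeeping between subquotients of representations — the context of the consumer).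
Nothing here is specific to the consumer.
-/

set_option autoImplicit false

namespace Literature.RepresentationTheory

open Representation Function

universe u u' v

/-! ## §1 The pushout extension of a `G`-map along the presentation -/

section Pushout

variable {k : Type u} [CommRing k] {G : Type u'} [Monoid G]
  {M₁ M₀ X Y : Type v} [AddCommGroup M₁] [Module k M₁] [AddCommGroup M₀] [Module k M₀]
  [AddCommGroup X] [Module k X] [AddCommGroup Y] [Module k Y]
  (ρ₁ : Representation k G M₁) (ρ₀ : Representation k G M₀) (ρV : Representation k G X) (ρW : Representation k G Y)
  (d : IntertwiningMap ρ₁ ρ₀) (ε : IntertwiningMap ρ₀ ρV)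

/-- **THE PUSHOUT RELATION MODULE `H = {(d c, −φ c)}` IS `G`-INVARIANT** in `C₀ × W` (with the product action), because `d` and `φ` intertwine.
[cite: Fuchs1970, §10 Theorem 10.2 (PDF pp. 52–53)] -/
theorem prod_range_le_comap (φ : IntertwiningMap ρ₁ ρW) (g : G) :
    LinearMap.range (d.toLinearMap.prod (-φ.toLinearMap)) ≤ (LinearMap.range (d.toLinearMap.prod (-φ.toLinearMap))).comap ((ρ₀.prod ρW) g) := by
  rintro x ⟨c, rfl⟩
  rw [Submodule.mem_comap]
  refine ⟨ρ₁ g c, ?_⟩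
  change (d (ρ₁ g c), -(φ (ρ₁ g c))) = (ρ₀ g (d c), ρW g (-(φ c)))
  rw [map_neg, IntertwiningMap.isIntertwining _ _ d g c, IntertwiningMap.isIntertwining _ _ φ g c]

/-- **THE PUSHOUT OF THE PRESENTATION ALONG `φ : C₁ → W` IS AN EXTENSION OF `V` BY `W`.**  On `E_φ := (C₀ × W) ⧸ H` (Mathlib `Representation.quotient` of `ρ₀.prod ρW`) the maps
`i : w ↦ [(0, w)]` and `p : [(c, w)] ↦ ε c` are `G`-maps with `i` injective (★ Fuchs (b): `d` is monic), `p` surjective (`ε` is) and `ker p = range i` (`ker ε = range d`: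
`[(d c₁, w)] = [(0, w + φ c₁)]`). [cite: Fuchs1970, §10 Theorem 10.2 and (b) (PDF pp. 52–53)] [cite: Weibel1994, §3.4 Thm. 3.4.3] -/
theorem exists_pushout_extension (hd : Injective d) (hexact : LinearMap.ker ε.toLinearMap = LinearMap.range d.toLinearMap) (hε : Surjective ε)
    (φ : IntertwiningMap ρ₁ ρW) :
    ∃ (i : IntertwiningMap ρW ((ρ₀.prod ρW).quotient (LinearMap.range (d.toLinearMap.prod (-φ.toLinearMap))) (prod_range_le_comap ρ₁ ρ₀ ρW d φ)))
      (p : IntertwiningMap ((ρ₀.prod ρW).quotient (LinearMap.range (d.toLinearMap.prod (-φ.toLinearMap))) (prod_range_le_comap ρ₁ ρ₀ ρW d φ)) ρV),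
      Injective i ∧ LinearMap.ker p.toLinearMap = LinearMap.range i.toLinearMap ∧ Surjective p ∧
        (∀ w : Y, i w = Submodule.Quotient.mk (0, w)) ∧ ∀ (c : M₀) (w : Y), p (Submodule.Quotient.mk (c, w)) = ε c := by
  set H : Submodule k (M₀ × Y) := LinearMap.range (d.toLinearMap.prod (-φ.toLinearMap)) with hH
  -- `i := mkQ ∘ inr`
  let il : Y →ₗ[k] (M₀ × Y) ⧸ H := H.mkQ ∘ₗ LinearMap.inr k M₀ Y
  have hil : ∀ (g : G) (w : Y), il (ρW g w) = (ρ₀.prod ρW).quotient H (prod_range_le_comap ρ₁ ρ₀ ρW d φ) g (il w) := fun g w => by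
    change Submodule.Quotient.mk (0, ρW g w) = (ρ₀.prod ρW).quotient H (prod_range_le_comap ρ₁ ρ₀ ρW d φ) g (Submodule.Quotient.mk (0, w))
    rw [Representation.quotient_apply, Submodule.mapQ_apply]
    change Submodule.Quotient.mk (0, ρW g w) = Submodule.Quotient.mk (ρ₀ g 0, ρW g w)
    rw [map_zero]
  -- `p := liftQ (ε ∘ fst)`
  have hle : H ≤ LinearMap.ker (ε.toLinearMap ∘ₗ LinearMap.fst k M₀ Y) := by
    rintro x ⟨c, rfl⟩
    change ε (d c) = 0
    have hc : d c ∈ LinearMap.ker ε.toLinearMap := by rw [hexact]; exact ⟨c, rfl⟩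
    exact hc
  let pl : (M₀ × Y) ⧸ H →ₗ[k] X := H.liftQ (ε.toLinearMap ∘ₗ LinearMap.fst k M₀ Y) hle
  have hpl_mk : ∀ (c : M₀) (w : Y), pl (Submodule.Quotient.mk (c, w)) = ε c := fun c w => rfl
  have hpl : ∀ (g : G) (x : (M₀ × Y) ⧸ H), pl ((ρ₀.prod ρW).quotient H (prod_range_le_comap ρ₁ ρ₀ ρW d φ) g x) = ρV g (pl x) := fun g x => by
    obtain ⟨⟨c, w⟩, rfl⟩ := Submodule.Quotient.mk_surjective H x
    rw [Representation.quotient_apply, Submodule.mapQ_apply]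
    change pl (Submodule.Quotient.mk (ρ₀ g c, ρW g w)) = ρV g (pl (Submodule.Quotient.mk (c, w)))
    rw [hpl_mk, hpl_mk, IntertwiningMap.isIntertwining _ _ ε g c]
  refine ⟨il.intertwiningMap_of_isIntertwiningMap _ _ hil, pl.intertwiningMap_of_isIntertwiningMap _ _ hpl, ?_, ?_, ?_, fun w => rfl, fun c w => rfl⟩
  · -- `i` injective: ★ Fuchs (b), `d` monic
    exact Literature.Algebra.Module.PullbackPushout.pushout_inr_injective d.toLinearMap φ.toLinearMap hd
  · -- `ker p = range i`
    apply le_antisymm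
    · intro x hx
      obtain ⟨⟨c, w⟩, rfl⟩ := Submodule.Quotient.mk_surjective H x
      have hc : c ∈ LinearMap.range d.toLinearMap := by
        rw [← hexact, LinearMap.mem_ker]
        exact hx
      obtain ⟨c₁, rfl⟩ := hc
      refine ⟨w + φ c₁, ?_⟩
      change Submodule.Quotient.mk (0, w + φ c₁) = Submodule.Quotient.mk (d.toLinearMap c₁, w)
      rw [Submodule.Quotient.eq]
      refine ⟨-c₁, Prod.ext ?_ ?_⟩
      · change d (-c₁) = 0 - d c₁
        rw [map_neg, zero_sub]
      · change -(φ (-c₁)) = (w + φ c₁) - w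
        rw [map_neg, neg_neg, add_sub_cancel_left]
    · rintro x ⟨w, rfl⟩
      rw [LinearMap.mem_ker]
      change pl (Submodule.Quotient.mk (0, w)) = 0
      rw [hpl_mk, map_zero]
  · -- `p` surjective
    intro x
    obtain ⟨c, rfl⟩ := hε x
    exact ⟨Submodule.Quotient.mk (c, 0), rfl⟩

end Pushout

/-! ## §2 The sentence: every `G`-map `C₁ → W` extends to `C₀` -/

section Sentence

variable {k : Type u} [CommRing k] {G : Type u'} [Monoid G]
  {M₁ M₀ X Y : Type v} [AddCommGroup M₁] [Module k M₁] [AddCommGroup M₀] [Module k M₀]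
  [AddCommGroup X] [Module k X] [AddCommGroup Y] [Module k Y]
  (ρ₁ : Representation k G M₁) (ρ₀ : Representation k G M₀) (ρV : Representation k G X) (ρW : Representation k G Y)
  (d : IntertwiningMap ρ₁ ρ₀) (ε : IntertwiningMap ρ₀ ρV)

/-- **IF EVERY EXTENSION OF `V` BY `W` SPLITS, EVERY `G`-MAP `C₁ → W` EXTENDS ALONG `d` TO `C₀`.**  For a length-one presentation `0 → C₁ —d→ C₀ —ε→ V → 0` and a target `W` all of
whose extensions by `V` split (`hsplit`, in ★ G2's letters `ker p = range i`), any `φ : C₁ → W` equals `ψ ∘ d` for a `G`-map `ψ : C₀ → W`: take the pushout extension `E_φ` (§1), a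
section `s` of its `p`, and `ψ := i⁻¹ ∘ (c ↦ [(c, 0)] − s (ε c))`. [cite: Weibel1994, §3.4 Thm. 3.4.3] [cite: Fuchs1970, §10 Theorem 10.2 (PDF pp. 52–53)] -/
theorem exists_comp_eq_of_forall_extension_split (hd : Injective d) (hexact : LinearMap.ker ε.toLinearMap = LinearMap.range d.toLinearMap) (hε : Surjective ε)
    (hsplit : ∀ (E : Type v) [AddCommGroup E] [Module k E] (ρE : Representation k G E) (i : IntertwiningMap ρW ρE) (p : IntertwiningMap ρE ρV),
      Injective i → LinearMap.ker p.toLinearMap = LinearMap.range i.toLinearMap → Surjective p → ∃ s : IntertwiningMap ρV ρE, p.comp s = IntertwiningMap.id ρV)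
    (φ : IntertwiningMap ρ₁ ρW) : ∃ ψ : IntertwiningMap ρ₀ ρW, ψ.comp d = φ := by
  obtain ⟨i, p, hi, hker, hp, hi_apply, hp_apply⟩ := exists_pushout_extension ρ₁ ρ₀ ρV ρW d ε hd hexact hε φ
  obtain ⟨s, hs⟩ := hsplit _ _ i p hi hker hp
  have hps : ∀ x : X, p (s x) = x := fun x => by
    have := congrArg (fun f : IntertwiningMap ρV ρV => f x) hs
    simpa using this
  -- `L c := [(c, 0)] − s (ε c)` lies in `ker p = range i`
  let L : M₀ →ₗ[k] (M₀ × Y) ⧸ LinearMap.range (d.toLinearMap.prod (-φ.toLinearMap)) :=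
    (LinearMap.range (d.toLinearMap.prod (-φ.toLinearMap))).mkQ ∘ₗ LinearMap.inl k M₀ Y - s.toLinearMap ∘ₗ ε.toLinearMap
  have hLv : ∀ c : M₀, L c = Submodule.Quotient.mk (c, 0) - s (ε c) := fun c => rfl
  have hL : ∀ c : M₀, L c ∈ LinearMap.range i.toLinearMap := fun c => by
    rw [← hker, LinearMap.mem_ker, IntertwiningMap.toLinearMap_apply, hLv, map_sub, hp_apply, hps, sub_self]
  -- `L` intertwines `ρ₀` with `ρE`
  have hLg : ∀ (g : G) (c : M₀), L (ρ₀ g c) =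
      (ρ₀.prod ρW).quotient (LinearMap.range (d.toLinearMap.prod (-φ.toLinearMap))) (prod_range_le_comap ρ₁ ρ₀ ρW d φ) g (L c) := fun g c => by
    rw [hLv, hLv, map_sub, IntertwiningMap.isIntertwining _ _ ε g c, IntertwiningMap.isIntertwining _ _ s g (ε c),
      Representation.quotient_apply, Submodule.mapQ_apply]
    change Submodule.Quotient.mk (ρ₀ g c, 0) - _ = Submodule.Quotient.mk (ρ₀ g c, ρW g 0) - _
    rw [map_zero]
  -- `ψ := i⁻¹ ∘ L`
  have hi' : Injective i.toLinearMap := fun a b h => hi h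
  let e := LinearEquiv.ofInjective i.toLinearMap hi'
  let ψl : M₀ →ₗ[k] Y := e.symm.toLinearMap ∘ₗ L.codRestrict (LinearMap.range i.toLinearMap) hL
  have hiψ : ∀ c : M₀, i (ψl c) = L c := fun c => by
    have h := congrArg Subtype.val (e.apply_symm_apply ⟨L c, hL c⟩)
    exact h
  have hψg : ∀ (g : G) (c : M₀), ψl (ρ₀ g c) = ρW g (ψl c) := fun g c =>
    hi (by rw [hiψ, hLg, ← hiψ, IntertwiningMap.isIntertwining _ _ i g (ψl c)])
  refine ⟨ψl.intertwiningMap_of_isIntertwiningMap _ _ hψg, IntertwiningMap.ext (LinearMap.ext fun c₁ => hi ?_)⟩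
  change i (ψl (d c₁)) = i (φ c₁)
  rw [hiψ, hLv, hi_apply]
  have h0 : ε (d c₁) = 0 := by
    have : d c₁ ∈ LinearMap.ker ε.toLinearMap := by rw [hexact]; exact ⟨c₁, rfl⟩
    exact this
  rw [h0, map_zero, sub_zero, Submodule.Quotient.eq]
  exact ⟨c₁, Prod.ext (by change d c₁ = d c₁ - 0; rw [sub_zero]) (by change -(φ c₁) = 0 - φ c₁; rw [zero_sub])⟩

/-- **MAP FORM: THE RESTRICTION `Hom_G(C₀, W) → Hom_G(C₁, W)`, `ψ ↦ ψ ∘ d`, IS SURJECTIVE** when every extension of `V` by `W` splits. [cite: Weibel1994, §3.4 Thm. 3.4.3] -/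
theorem comp_surjective_of_forall_extension_split (hd : Injective d) (hexact : LinearMap.ker ε.toLinearMap = LinearMap.range d.toLinearMap) (hε : Surjective ε)
    (hsplit : ∀ (E : Type v) [AddCommGroup E] [Module k E] (ρE : Representation k G E) (i : IntertwiningMap ρW ρE) (p : IntertwiningMap ρE ρV),
      Injective i → LinearMap.ker p.toLinearMap = LinearMap.range i.toLinearMap → Surjective p → ∃ s : IntertwiningMap ρV ρE, p.comp s = IntertwiningMap.id ρV) :
    Surjective (fun ψ : IntertwiningMap ρ₀ ρW => ψ.comp d) := fun φ =>
  exists_comp_eq_of_forall_extension_split ρ₁ ρ₀ ρV ρW d ε hd hexact hε hsplit φ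

end Sentence

/-! ## §3 The four-term exact sequence and the dimension count -/

section Count

variable {k : Type u} [Field k] {G : Type u'} [Monoid G]
  {M₁ M₀ X Y : Type v} [AddCommGroup M₁] [Module k M₁] [AddCommGroup M₀] [Module k M₀]
  [AddCommGroup X] [Module k X] [AddCommGroup Y] [Module k Y]
  (ρ₁ : Representation k G M₁) (ρ₀ : Representation k G M₀) (ρV : Representation k G X) (ρW : Representation k G Y)
  (d : IntertwiningMap ρ₁ ρ₀) (ε : IntertwiningMap ρ₀ ρV)

/-- **`χ ↦ χ ∘ ε : Hom_G(V, W) → Hom_G(C₀, W)` IS INJECTIVE** for `ε` surjective. [cite: BernsteinZelevinsky1976, §2.1–§2.4] -/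
theorem comp_injective_of_surjective (hε : Surjective ε) : Injective (fun χ : IntertwiningMap ρV ρW => χ.comp ε) := by
  intro χ χ' h
  refine IntertwiningMap.ext (LinearMap.ext fun x => ?_)
  obtain ⟨c, rfl⟩ := hε x
  have := congrArg (fun f : IntertwiningMap ρ₀ ρW => f c) h
  simpa using this

/-- **EXACTNESS AT `Hom_G(C₀, W)`**: a `G`-map `ψ : C₀ → W` restricts to `0` on `C₁` iff it factors through `ε` — `ψ` kills `range d = ker ε` and descends along the surjection `ε`
(`Submodule.liftQ` + `quotKerEquivOfSurjective`; the descended map intertwines because `ε` does). [cite: BernsteinZelevinsky1976, §2.1–§2.4] [cite: Weibel1994, §3.4 Thm. 3.4.3] -/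
theorem comp_eq_zero_iff_exists_comp_eq (hexact : LinearMap.ker ε.toLinearMap = LinearMap.range d.toLinearMap) (hε : Surjective ε)
    (ψ : IntertwiningMap ρ₀ ρW) : ψ.comp d = 0 ↔ ∃ χ : IntertwiningMap ρV ρW, χ.comp ε = ψ := by
  constructor
  · intro h
    have hvan : LinearMap.ker ε.toLinearMap ≤ LinearMap.ker ψ.toLinearMap := by
      rw [hexact]
      rintro x ⟨c, rfl⟩
      rw [LinearMap.mem_ker]
      have := congrArg (fun f : IntertwiningMap ρ₁ ρW => f c) h
      simpa using this
    let χl : X →ₗ[k] Y := ((LinearMap.ker ε.toLinearMap).liftQ ψ.toLinearMap hvan) ∘ₗ (ε.toLinearMap.quotKerEquivOfSurjective hε).symm.toLinearMap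
    have hχl : ∀ c : M₀, χl (ε c) = ψ c := fun c => by
      change ((LinearMap.ker ε.toLinearMap).liftQ ψ.toLinearMap hvan) ((ε.toLinearMap.quotKerEquivOfSurjective hε).symm (ε.toLinearMap c)) = ψ c
      rw [LinearMap.quotKerEquivOfSurjective_symm_apply, Submodule.liftQ_apply]
      rfl
    have hχg : ∀ (g : G) (x : X), χl (ρV g x) = ρW g (χl x) := fun g x => by
      obtain ⟨c, rfl⟩ := hε x
      rw [← IntertwiningMap.isIntertwining _ _ ε g c, hχl, hχl, IntertwiningMap.isIntertwining _ _ ψ g c]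
    refine ⟨χl.intertwiningMap_of_isIntertwiningMap _ _ hχg, IntertwiningMap.ext (LinearMap.ext fun c => ?_)⟩
    exact hχl c
  · rintro ⟨χ, rfl⟩
    refine IntertwiningMap.ext (LinearMap.ext fun c => ?_)
    have h0 : ε (d c) = 0 := by
      have : d c ∈ LinearMap.ker ε.toLinearMap := by rw [hexact]; exact ⟨c, rfl⟩
      exact this
    change χ (ε (d c)) = 0
    rw [h0, map_zero]

/-- **`dim_k Hom_G(C₀, W) = dim_k Hom_G(V, W) + dim_k Hom_G(C₁, W)`** for a length-one presentation `0 → C₁ → C₀ → V → 0` and a target `W` all of whose extensions by `V` split, with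
`Hom_G(C₀, W)` finite-dimensional: rank–nullity for the restriction `ψ ↦ ψ ∘ d` (surjective, §2; kernel `≅ Hom_G(V, W)`, this §).  This is «`Σ_q (−1)^q dim Hom_G(C_q, W) = dim Hom_G(V, W)`
when `Ext¹_G(V, W) = 0`» stated without `Ext`. [cite: Weibel1994, §3.4 Thm. 3.4.3] [cite: BernsteinZelevinsky1976, §2.1–§2.4] -/
theorem finrank_intertwiningMap_presentation (hd : Injective d) (hexact : LinearMap.ker ε.toLinearMap = LinearMap.range d.toLinearMap) (hε : Surjective ε)
    (hsplit : ∀ (E : Type v) [AddCommGroup E] [Module k E] (ρE : Representation k G E) (i : IntertwiningMap ρW ρE) (p : IntertwiningMap ρE ρV),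
      Injective i → LinearMap.ker p.toLinearMap = LinearMap.range i.toLinearMap → Surjective p → ∃ s : IntertwiningMap ρV ρE, p.comp s = IntertwiningMap.id ρV)
    [FiniteDimensional k (IntertwiningMap ρ₀ ρW)] :
    Module.finrank k (IntertwiningMap ρ₀ ρW) = Module.finrank k (IntertwiningMap ρV ρW) + Module.finrank k (IntertwiningMap ρ₁ ρW) := by
  -- the restriction `res : ψ ↦ ψ ∘ d` and the inflation `inf : χ ↦ χ ∘ ε`, `k`-linear
  let res : IntertwiningMap ρ₀ ρW →ₗ[k] IntertwiningMap ρ₁ ρW := (IntertwiningMap.llcomp ρ₁ ρ₀ ρW).flip d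
  have hres : ∀ ψ, res ψ = ψ.comp d := fun ψ => rfl
  let inf : IntertwiningMap ρV ρW →ₗ[k] IntertwiningMap ρ₀ ρW := (IntertwiningMap.llcomp ρ₀ ρV ρW).flip ε
  have hinf : ∀ χ, inf χ = χ.comp ε := fun χ => rfl
  -- `res` surjective, `inf` injective, `range inf = ker res`
  have hsurj : LinearMap.range res = ⊤ :=
    LinearMap.range_eq_top.2 (comp_surjective_of_forall_extension_split ρ₁ ρ₀ ρV ρW d ε hd hexact hε hsplit)
  have hinj : Injective inf := comp_injective_of_surjective ρ₀ ρV ρW ε hε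
  have hrk : LinearMap.range inf = LinearMap.ker res := by
    ext ψ
    rw [LinearMap.mem_range, LinearMap.mem_ker, hres, comp_eq_zero_iff_exists_comp_eq ρ₁ ρ₀ ρV ρW d ε hexact hε ψ]
    exact ⟨fun ⟨y, hy⟩ => ⟨y, hy⟩, fun ⟨y, hy⟩ => ⟨y, hy⟩⟩
  -- rank–nullity
  have h := LinearMap.finrank_range_add_finrank_ker res
  rw [hsurj, finrank_top, ← hrk, LinearMap.finrank_range_of_inj hinj] at h
  omega

end Count

end Literature.RepresentationTheory
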